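import Summits.Ventures.PercRepro.GenQClassTwelveSixteen

/-!
# PercRepro — the corank-`12` split, part F: four `16`-traces and no `15`-trace leave no `17`-trace (night-4, gen 14)

At `n = 19` with `h₁₅ = 0`, two distinct `16`-traces meet `G` in `13` or `15` points (part E: not `14`, at most `15`).
If some pair meets in `15` points, its intersection `F` (a rank-`5` flat) lies inside every `16`-trace and every `17`-trace
(`≥ 12`, resp. `≥ 13 > 10` common points); a `17`-trace `K` is then `cl(F ∪ x)` for either of its two points outside
`F`, so no `16`-trace (also `cl(F ∪ y)` for its single outside point `y`) may contain `x`: the `16`-traces use the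
`4 − 2 = 2` remaining outside points, `h₁₆ ≤ 2`.  If every pair meets in `13` points, the four complements are pairwise
disjoint and four traces meet in a flat of rank `≤ 3` with `7` points (part E's argument, `false_of_four_disjoint`).
Hence **`hypTr_seventeen_eq_zero_of_four_fifteen_zero`**: `h₁₆ ≥ 4 ∧ h₁₅ = 0 ⇒ h₁₇ = 0` — the class
`(h₁₇ = 1, h₁₆ = 4, h₁₅ = 0)` of the corank-`12` split (`−28,162` on tree rows) is empty, and `(0, 4, 0, h₁₄ ≥ 1)` is
`+186,931` (kit j270928).  Imports `GenQClassTwelveSixteen` (parts A–E).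
-/
namespace PercRepro.Night4

open Finset ThmH SixFour GenQ PerFlat Star

variable {α : Type*} [DecidableEq α] {M : Matroid α} [M.Finite]

/-- Four distinct `16`-traces of a `19`-point set whose complements are pairwise disjoint cannot exist on the core:
their intersection is a flat of rank `≤ 3` with `≥ 7` points. -/
theorem false_of_four_disjoint (hs : Simple M) (hline : ∀ L ∈ flatsQ M 2, L.card ≤ 3)
    (hplane : ∀ P ∈ flatsQ M 3, P.card ≤ 6) (hsolid : ∀ F ∈ flatsQ M 4, F.card ≤ 10) {G : Finset α}
    (hcard : G.card = 19) {H₁ H₂ H₃ H₄ : Finset α} (hH₁ : H₁ ∈ flatsTr M G 6 16) (hH₂ : H₂ ∈ flatsTr M G 6 16)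
    (hH₃ : H₃ ∈ flatsTr M G 6 16) (hH₄ : H₄ ∈ flatsTr M G 6 16) (h12 : H₁ ≠ H₂)
    (m13 : ∀ {x : α}, x ∈ G → x ∈ H₁ ∨ x ∈ H₃) (m14 : ∀ {x : α}, x ∈ G → x ∈ H₁ ∨ x ∈ H₄)
    (m23 : ∀ {x : α}, x ∈ G → x ∈ H₂ ∨ x ∈ H₃) (m24 : ∀ {x : α}, x ∈ G → x ∈ H₂ ∨ x ∈ H₄)
    (m34 : ∀ {x : α}, x ∈ G → x ∈ H₃ ∨ x ∈ H₄) : False := by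
  have hB := flats_le_four_card_le_ten hs hline hplane hsolid
  have hB3 := flats_le_three_card_le_six hs hline hplane
  have hout : ∀ {H H' : Finset α}, (∀ {x : α}, x ∈ G → x ∈ H ∨ x ∈ H') →
      ∀ {c : α}, c ∈ G → c ∉ H' → c ∈ H := by
    intro H H' hm c hc hcH'
    rcases hm hc with h | h
    · exact h
    · exact absurd h hcH'
  have hGH : ∀ {H : Finset α}, H ∈ flatsTr M G 6 16 → (G \ H).card = 3 := by
    intro H hH
    rw [Finset.card_sdiff, hcard, (mem_flatsTr.1 hH).2.1]
  have hF : H₁ ∩ H₂ ∈ flatsQ M 5 :=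
    inter_mem_flatsQ_of_large_traces (q := 7) (s := 16) (B := 10) (by norm_num) hB hH₁ hH₂ h12 (by omega)
  have hnot3 : ¬ H₁ ∩ H₂ ⊆ H₃ := by
    intro hsub
    obtain ⟨c, hc⟩ : (G \ H₃).Nonempty := by rw [← Finset.card_pos, hGH hH₃]; norm_num
    rw [Finset.mem_sdiff] at hc
    exact hc.2 (hsub (Finset.mem_inter.2 ⟨hout m13 hc.1 hc.2, hout m23 hc.1 hc.2⟩))
  obtain ⟨b, hS, hb⟩ := exists_inter_mem_flatsQ_lt_of_not_subset hF (mem_flatsQ.1 (mem_flatsTr.1 hH₃).1).2.1 hnot3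
  have hnot4 : ¬ (H₁ ∩ H₂) ∩ H₃ ⊆ H₄ := by
    intro hsub
    obtain ⟨c, hc⟩ : (G \ H₄).Nonempty := by rw [← Finset.card_pos, hGH hH₄]; norm_num
    rw [Finset.mem_sdiff] at hc
    exact hc.2 (hsub (Finset.mem_inter.2 ⟨Finset.mem_inter.2 ⟨hout m14 hc.1 hc.2, hout m24 hc.1 hc.2⟩,
      hout m34 hc.1 hc.2⟩))
  obtain ⟨b', hP, hb'⟩ := exists_inter_mem_flatsQ_lt_of_not_subset hS (mem_flatsQ.1 (mem_flatsTr.1 hH₄).1).2.1 hnot4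
  have hsix : (((H₁ ∩ H₂) ∩ H₃) ∩ H₄).card ≤ 6 := hB3 b' (by omega) _ hP
  have hcover : G \ (((H₁ ∩ H₂) ∩ H₃) ∩ H₄) ⊆ (G \ H₁) ∪ ((G \ H₂) ∪ ((G \ H₃) ∪ (G \ H₄))) := by
    intro x hx
    simp only [Finset.mem_sdiff, Finset.mem_inter, Finset.mem_union] at hx ⊢
    by_cases h1 : x ∈ H₁
    · by_cases h2 : x ∈ H₂
      · by_cases h3 : x ∈ H₃
        · exact Or.inr (Or.inr (Or.inr ⟨hx.1, fun h4 => hx.2 ⟨⟨⟨h1, h2⟩, h3⟩, h4⟩⟩))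
        · exact Or.inr (Or.inr (Or.inl ⟨hx.1, h3⟩))
      · exact Or.inr (Or.inl ⟨hx.1, h2⟩)
    · exact Or.inl ⟨hx.1, h1⟩
  have hle := (Finset.card_le_card hcover).trans ((Finset.card_union_le _ _).trans (Nat.add_le_add_left
    ((Finset.card_union_le _ _).trans (Nat.add_le_add_left (Finset.card_union_le _ _) _)) _))
  rw [hGH hH₁, hGH hH₂, hGH hH₃, hGH hH₄] at hle
  have hsd := Finset.card_sdiff (s := ((H₁ ∩ H₂) ∩ H₃) ∩ H₄) (t := G)
  have hsub := Finset.card_le_card (Finset.inter_subset_left : (((H₁ ∩ H₂) ∩ H₃) ∩ H₄) ∩ G ⊆ ((H₁ ∩ H₂) ∩ H₃) ∩ H₄)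
  omega

/-- Every point of `G` lies in one of two distinct `16`-traces meeting `G` in `13` points (`n = 19`). -/
theorem mem_or_mem_of_card_inter_eq_thirteen {G H₁ H₂ : Finset α} (hcard : G.card = 19)
    (hH₁ : H₁ ∈ flatsTr M G 6 16) (hH₂ : H₂ ∈ flatsTr M G 6 16) (h13 : ((H₁ ∩ H₂) ∩ G).card = 13) {x : α}
    (hx : x ∈ G) : x ∈ H₁ ∨ x ∈ H₂ := by
  have h1 := mem_flatsTr.1 hH₁
  have h2 := mem_flatsTr.1 hH₂
  have hU : (H₁ ∩ G) ∪ (H₂ ∩ G) ⊆ G := by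
    intro z hz
    simp only [Finset.mem_union, Finset.mem_inter] at hz
    rcases hz with hz | hz
    · exact hz.2
    · exact hz.2
  have hUcard : ((H₁ ∩ G) ∪ (H₂ ∩ G)).card = 19 := by
    have := Finset.card_union_add_card_inter (H₁ ∩ G) (H₂ ∩ G)
    rw [← inter_inter_eq, h13, h1.2.1, h2.2.1] at this
    omega
  have heq : (H₁ ∩ G) ∪ (H₂ ∩ G) = G := Finset.eq_of_subset_of_card_le hU (by omega)
  have hx' : x ∈ (H₁ ∩ G) ∪ (H₂ ∩ G) := by rw [heq]; exact hx
  simp only [Finset.mem_union, Finset.mem_inter] at hx'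
  rcases hx' with hx' | hx'
  · exact Or.inl hx'.1
  · exact Or.inr hx'.1

/-- **Four `16`-traces and no `15`-trace leave no `17`-trace** (`n = 19`, the core). -/
theorem hypTr_seventeen_eq_zero_of_four_fifteen_zero (hs : Simple M) (hline : ∀ L ∈ flatsQ M 2, L.card ≤ 3)
    (hplane : ∀ P ∈ flatsQ M 3, P.card ≤ 6) (hsolid : ∀ F ∈ flatsQ M 4, F.card ≤ 10) {G : Finset α}
    (hG : G ⊆ gr M) (hcard : G.card = 19) (h16 : 4 ≤ hypTr M G 6 16) (h15 : hypTr M G 6 15 = 0) :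
    hypTr M G 6 17 = 0 := by
  have hB := flats_le_four_card_le_ten hs hline hplane hsolid
  -- four distinct `16`-traces
  obtain ⟨H₁, H₂, H₃, hH₁, hH₂, hH₃, h12, h13, h23⟩ :=
    Finset.two_lt_card_iff.1 (by unfold hypTr at h16; omega : 2 < (flatsTr M G 6 16).card)
  obtain ⟨H₄, hH₄'⟩ : ((flatsTr M G 6 16) \ {H₁, H₂, H₃}).Nonempty := by
    rw [← Finset.card_pos]
    have hle := Finset.card_le_card (Finset.inter_subset_right : (flatsTr M G 6 16) ∩ {H₁, H₂, H₃} ⊆ {H₁, H₂, H₃})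
    have h3 : ({H₁, H₂, H₃} : Finset (Finset α)).card ≤ 3 := Finset.card_le_three
    have := Finset.card_sdiff_add_card_inter (flatsTr M G 6 16) {H₁, H₂, H₃}
    unfold hypTr at h16
    omega
  rw [Finset.mem_sdiff, Finset.mem_insert, Finset.mem_insert, Finset.mem_singleton] at hH₄'
  obtain ⟨hH₄, hH₄ne⟩ := hH₄'
  have h14 : H₁ ≠ H₄ := fun h => hH₄ne (Or.inl h.symm)
  have h24 : H₂ ≠ H₄ := fun h => hH₄ne (Or.inr (Or.inl h.symm))
  have h34 : H₃ ≠ H₄ := fun h => hH₄ne (Or.inr (Or.inr h.symm))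
  -- the pairs meet in `13` or `15` points
  have hpair : ∀ {H H' : Finset α}, H ∈ flatsTr M G 6 16 → H' ∈ flatsTr M G 6 16 → H ≠ H' →
      ((H ∩ H') ∩ G).card = 13 ∨ ((H ∩ H') ∩ G).card = 15 := by
    intro H H' hH hH' hne
    have hle := card_inter_le_fifteen_n19 hH hH' hne
    have hge := two_mul_sub_le_card_inter_of_mem_flatsTr hH hH'
    have hn14 := card_inter_ne_fourteen_n19 hs hline hplane hsolid hG hcard h15 hH hH' hne
    omega
  -- a pair meeting in `15` points: `F` lies in every `16`- and `17`-trace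
  have hbig : ∀ {H H' : Finset α}, H ∈ flatsTr M G 6 16 → H' ∈ flatsTr M G 6 16 → H ≠ H' →
      ((H ∩ H') ∩ G).card = 15 → hypTr M G 6 17 = 0 := by
    intro H H' hH hH' hne hf
    have hF : H ∩ H' ∈ flatsQ M 5 :=
      inter_mem_flatsQ_of_large_traces (q := 7) (s := 16) (B := 10) (by norm_num) hB hH hH' hne (by omega)
    unfold hypTr
    rw [Finset.card_eq_zero, Finset.eq_empty_iff_forall_notMem]
    intro K hK
    have hK1 := mem_flatsTr.1 hK
    have hFK : H ∩ H' ⊆ K := subset_of_card_add_card hB hF hK (by omega)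
    -- the `16`-traces through `F` and their outside points; the two outside points of `K` are not among them
    have hall : ∀ L ∈ flatsTr M G 6 16, H ∩ H' ⊆ L := fun L hL => subset_of_card_add_card hB hF hL (by omega)
    have hKout : ∀ L ∈ flatsTr M G 6 16, ∀ x ∈ (K ∩ G) \ (H ∩ H'), x ∉ L := by
      intro L hL x hx hxL
      rw [Finset.mem_sdiff, Finset.mem_inter] at hx
      have hxE : x ∈ M.E := by
        rw [← coe_gr M]
        exact Finset.mem_coe.2 (hG hx.1.2)
      exact ne_of_mem_flatsTr_of_card_ne hL hK (by norm_num)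
        (eq_of_mem_of_subset_flatsQ_six hF (mem_flatsTr.1 hL).1 hK1.1 (hall L hL) hFK hxE hx.2 hxL hx.1.1)
    -- `L ↦ (L ∩ G) ∖ F` is injective into the `1`-subsets of `(G ∖ F) ∖ (K ∩ G)`, a set of `4 − 2 = 2` points
    have hO : ((G \ (H ∩ H')) \ (K ∩ G)).card = 2 := by
      have hKF : (K ∩ G) \ (H ∩ H') ⊆ G \ (H ∩ H') := by
        intro x hx
        rw [Finset.mem_sdiff, Finset.mem_inter] at hx
        rw [Finset.mem_sdiff]
        exact ⟨hx.1.2, hx.2⟩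
      have hEq : (G \ (H ∩ H')) \ (K ∩ G) = (G \ (H ∩ H')) \ ((K ∩ G) \ (H ∩ H')) := by
        ext x
        simp only [Finset.mem_sdiff, Finset.mem_inter]
        tauto
      have hFK' : (H ∩ H') ∩ (K ∩ G) = (H ∩ H') ∩ G := by
        ext x
        simp only [Finset.mem_inter]
        constructor
        · intro hx; exact ⟨hx.1, hx.2.2⟩
        · intro hx; exact ⟨hx.1, hFK (Finset.mem_inter.2 hx.1), hx.2⟩
      rw [hEq, Finset.card_sdiff_of_subset hKF, Finset.card_sdiff, Finset.card_sdiff, hFK', hK1.2.1, hf, hcard]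
    have hmaps : Set.MapsTo (fun L : Finset α => (L ∩ G) \ (H ∩ H')) (flatsTr M G 6 16 : Set (Finset α))
        (((G \ (H ∩ H')) \ (K ∩ G)).powersetCard 1 : Set (Finset α)) := by
      intro L hL
      rw [Finset.mem_coe] at hL ⊢
      have hL' := mem_flatsTr.1 hL
      rw [Finset.mem_powersetCard]
      refine ⟨?_, ?_⟩
      · intro x hx
        have hx' := hx
        rw [Finset.mem_sdiff, Finset.mem_inter] at hx
        rw [Finset.mem_sdiff, Finset.mem_sdiff]
        refine ⟨⟨hx.1.2, hx.2⟩, fun hxK => ?_⟩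
        exact hKout L hL x (Finset.mem_sdiff.2 ⟨hxK, hx.2⟩) hx.1.1
      · have hFsub : (H ∩ H') ∩ (L ∩ G) = (H ∩ H') ∩ G := by
          ext x
          constructor
          · intro hx
            rw [Finset.mem_inter] at hx ⊢
            exact ⟨hx.1, (Finset.mem_inter.1 hx.2).2⟩
          · intro hx
            rw [Finset.mem_inter] at hx ⊢
            exact ⟨hx.1, Finset.mem_inter.2 ⟨hall L hL hx.1, hx.2⟩⟩
        rw [Finset.card_sdiff, hFsub, hL'.2.1, hf]
    have hinj : Set.InjOn (fun L : Finset α => (L ∩ G) \ (H ∩ H')) (flatsTr M G 6 16 : Set (Finset α)) := by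
      intro L hL L' hL' heq
      rw [Finset.mem_coe] at hL hL'
      simp only at heq
      have hdecomp : ∀ N ∈ flatsTr M G 6 16, N ∩ G = ((H ∩ H') ∩ G) ∪ ((N ∩ G) \ (H ∩ H')) := by
        intro N hN
        ext x
        rw [Finset.mem_union, Finset.mem_sdiff]
        constructor
        · intro hx
          by_cases hxF : x ∈ H ∩ H'
          · exact Or.inl (Finset.mem_inter.2 ⟨hxF, (Finset.mem_inter.1 hx).2⟩)
          · exact Or.inr ⟨hx, hxF⟩
        · rintro (hx | hx)
          · rw [Finset.mem_inter] at hx ⊢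
            exact ⟨hall N hN hx.1, hx.2⟩
          · exact hx.1
      exact eq_of_inter_eq_of_mem_flatsTr hL hL' (by rw [hdecomp L hL, hdecomp L' hL', heq])
    have hle := Finset.card_le_card_of_injOn _ hmaps hinj
    rw [Finset.card_powersetCard, hO] at hle
    unfold hypTr at h16
    have : Nat.choose 2 1 = 2 := by decide
    omega
  rcases hpair hH₁ hH₂ h12 with h | h
  · rcases hpair hH₁ hH₃ h13 with h' | h'
    · rcases hpair hH₁ hH₄ h14 with h'' | h''
      · rcases hpair hH₂ hH₃ h23 with g | g
        · rcases hpair hH₂ hH₄ h24 with g' | g'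
          · rcases hpair hH₃ hH₄ h34 with g'' | g''
            · exact (false_of_four_disjoint hs hline hplane hsolid hcard hH₁ hH₂ hH₃ hH₄ h12
                (fun hx => mem_or_mem_of_card_inter_eq_thirteen hcard hH₁ hH₃ h' hx)
                (fun hx => mem_or_mem_of_card_inter_eq_thirteen hcard hH₁ hH₄ h'' hx)
                (fun hx => mem_or_mem_of_card_inter_eq_thirteen hcard hH₂ hH₃ g hx)
                (fun hx => mem_or_mem_of_card_inter_eq_thirteen hcard hH₂ hH₄ g' hx)
                (fun hx => mem_or_mem_of_card_inter_eq_thirteen hcard hH₃ hH₄ g'' hx)).elim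
            · exact hbig hH₃ hH₄ h34 g''
          · exact hbig hH₂ hH₄ h24 g'
        · exact hbig hH₂ hH₃ h23 g
      · exact hbig hH₁ hH₄ h14 h''
    · exact hbig hH₁ hH₃ h13 h'
  · exact hbig hH₁ hH₂ h12 h

end PercRepro.Night4
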